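import Literature.AlgebraicGeometry.Motives.AbelianVariety
import Literature.AlgebraicGeometry.Motives.SubschemeCycles
import Literature.AlgebraicGeometry.Motives.BettiRealization
import HarnessLib

/-!
# The Jacobian variety of a curve

For a complete nonsingular curve `C` over a field `k`, the **Jacobian** `J = J(C)` is the abelian
variety over `k` representing (the sheafification of) `T ↦ Pic⁰(C × T)/Pic(T)`
(Milne, *Jacobian Varieties*, Thm. 1.1). It comes with the **difference map**
`F : C × C → J`, `(x, y) ↦ [x − y]` (Milne §6, before Prop. 6.4; Lange §4.5.3, `δ(x, y) =
α_c(x) − α_c(y) = 𝒪_C(x − y)`), which is defined over `k` whether or not `C` has a rational point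
and vanishes on the diagonal, and the pair `(J, F)` is **characterized** by the universal property
of Milne, Prop. 6.4 / Lange, Prop. 4.5.5: every `k`-morphism `φ : C × C → A` to an abelian variety
with `φ(Δ) = 0` factors as `φ = ψ ∘ F` for a unique homomorphism `ψ : J → A` (Milne, Remark 6.5:
"the pairs `(J, f^P)` and `(J, F)` are characterized by the universal properties in (6.1) and
(6.4)", i.e. `J` is the Albanese variety of `C`; Lange, Remark 4.5.6).

Mathlib has no Picard functor / `Pic⁰` of a scheme (searched `Pic`, `Picard`, `Jacobian`,
`Albanese` in `Mathlib/AlgebraicGeometry`: only `CommRing.Pic` of a ring), so we take this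
characterization as the DEFINITION:

* `Literature.AlgebraicGeometry.Motives.Jacobian C` — a Jacobian of the `k`-scheme `C` (intended:
  `IsSmoothProjective 1 C`): an abelian variety `J` (`Motives/AbelianVariety`), a morphism
  `diff : C ⊗ C ⟶ J.X` of `k`-schemes satisfying the cocycle identity `[x−y] + [y−z] = [x−z]`
  (immediate from `F(x, y) = f^P(x) − f^P(y)`, Milne §6), and the universal property `desc`/`fac`/
  `uniq` of Milne Prop. 6.4, in the style of Mathlib's `IsColimit`. PROVED consequences:
  `diag_diff` (`[x−x] = 0`), `diff_swap`, `hom_ext` (the image of `F` generates `J`),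
  `uniqueUpToIso` (two Jacobians of `C` are uniquely isomorphic, Milne §1 / Remark 6.5).
* `Jacobian.abelJacobi P : C ⟶ J.X` — the canonical map `f^P`, `x ↦ [x − P]`, of a rational point
  `P ∈ C(k)` (Milne §2; Lange §4.1.3 `α_c`), with `diff = f^P ∘ pr₁ − f^P ∘ pr₂`
  (`diff_eq_mul_inv`) and Milne **Prop. 6.1** PROVED from 6.4: `descPointed`,
  `abelJacobi_descPointed`, `descPointed_unique`.
* `Jacobian.pushforward f : J(C) ⟶ J(C')` for a `k`-morphism `f : C ⟶ C'` — Albanese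
  functoriality, i.e. the **norm map** `Nm_f = f_*`, `[Σ nᵢ xᵢ] ↦ [Σ nᵢ f(xᵢ)]` (Lange §4.5.2:
  "`N_f` … classically called the norm map of `f`"; §5.3.2), defined by the universal property;
  `diff_comp_pushforward`, `abelJacobi_comp_pushforward` (`N_f ∘ α_P = α_{f(P)} ∘ f`, Lange's
  defining square), `pushforward_id`, `pushforward_comp`, and over `k ⊆ ℂ` the induced
  commutative square in Betti cohomology (`bettiCohomology_map_pushforward_comp`), all proved.
* `jacobianVariety C h : AbelianVariety k` — the Jacobian variety of `C`, chosen once a Jacobian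
  is known to exist (`h : Nonempty (Jacobian C)`), e.g. by the named fact
  `nonempty_jacobian_of_isSmoothProjective` (Milne Thm. 1.1 with Prop. 6.4).
* Named facts over `ℂ` (cited, not proved): `isIso_bettiCohomology_map_abelJacobi`
  (`(f^P)^* : H¹(J(ℂ); ℚ) ≅ H¹(C(ℂ); ℚ)`, Lange §4.1.1 and proof of Lemma 4.4.1; Milne Thm. 2.5)
  and `two_mul_dim_eq_finrank_bettiCohomology` (`dim J = g = ½ b₁(C(ℂ))`, Milne Prop. 2.1;
  Lange §4.1.1).

## Deliberately not here

* The pull-back `f^* : J(C') → J(C)` of a finite `f` (Picard functoriality). It is not determined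
  by the Albanese property alone: `f^*` is the transpose of `Nm_f` under autoduality,
  `N̂_f ∘ φ_{Θ'} = φ_Θ ∘ f^*` (Lange §4.5.2 (4.9); Milne Thm. 6.6), and needs the dual abelian
  variety / polarizations, which `Motives/AbelianVariety` defers. Hecke-type endomorphisms of
  `J(C̃)` built from automorphisms `g` of `C̃` only need `pushforward g`.
* Prym varieties `(ker Nm_f)⁰` (Lange §5.3.2): combine `pushforward` with
  `Motives/AbelianVarietyKernelComponent.redSub`.
* The identification `J(k') = Pic⁰(C_{k'})` when `C(k') ≠ ∅` (Milne Thm. 1.1) and `dim J = genus`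
  over a general field (Milne Prop. 2.1): no `Pic`, no coherent cohomology of curves in Mathlib.

## References

* J. S. Milne, *Jacobian Varieties*, Ch. VII of Cornell–Silverman, *Arithmetic Geometry* (1986):
  Thm. 1.1, Prop. 2.1, Thm. 2.5, Prop. 6.1, Prop. 6.4, Remark 6.5, Thm. 6.6. [Milne1986JacobianVarieties]
* H. Lange, *Abelian Varieties over the Complex Numbers*, Grundlehren Text Editions (2023):
  §4.1.1–4.1.3, Lemma 4.4.1, Thm. 4.5.1, §4.5.2 (norm map), §4.5.3 Prop. 4.5.5, Remark 4.5.6,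
  §5.3.2. [Lange2023AbelianVarietiesC]
-/

universe u

open CategoryTheory AlgebraicGeometry MonoidalCategory CartesianMonoidalCategory

noncomputable section

namespace Literature.AlgebraicGeometry.Motives

open scoped MonObj

variable {k : Type u} [Field k]

/-- A **Jacobian** of the `k`-scheme `C` (intended: a smooth projective geometrically integral
curve, `IsSmoothProjective 1 C`): an abelian variety `J` over `k` with the *difference map*
`diff : C × C → J`, `(x, y) ↦ [x − y]`, satisfying the cocycle identity `[x−y] + [y−z] = [x−z]`
(written multiplicatively in Mathlib's group `Hom_k(T, J)` of `T`-valued points) and the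
universal property: every `k`-morphism `φ : C × C → A` to an abelian variety which is trivial on
the diagonal factors uniquely through `diff` by a homomorphism `J → A`. By Milne, Remark 6.5, this
characterizes the Jacobian `J` of Milne Thm. 1.1 (representing `Pic⁰`) together with its map
`F(x, y) = f^P(x) − f^P(y)`; the factorisation is data (`desc`), as in Mathlib's `IsColimit`.
[cite: Milne1986JacobianVarieties, §6 Prop. 6.4 and Remark 6.5] [cite: Lange2023AbelianVarietiesC, §4.5.3 Prop. 4.5.5 and Remark 4.5.6] -/
structure Jacobian (C : SchemeOver k) where
  /-- The Jacobian variety `J = J(C)`, an abelian variety over `k`. -/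
  J : AbelianVariety k
  /-- The difference map `F : C × C → J`, `(x, y) ↦ [x − y]` (Milne §6; Lange §4.5.3 `δ`). -/
  diff : C ⊗ C ⟶ J.X
  /-- `[x − y] + [y − z] = [x − z]` on `C × C × C` (points written multiplicatively). -/
  diff_cocycle :
    (lift (fst C (C ⊗ C)) (snd C (C ⊗ C) ≫ fst C C) ≫ diff) * (snd C (C ⊗ C) ≫ diff) =
      lift (fst C (C ⊗ C)) (snd C (C ⊗ C) ≫ snd C C) ≫ diff
  /-- The homomorphism `J → A` through which a `φ : C × C → A`, trivial on the diagonal, factors. -/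
  desc : ∀ {A : AbelianVariety k} (φ : C ⊗ C ⟶ A.X), lift (𝟙 C) (𝟙 C) ≫ φ = 1 → (J ⟶ A)
  /-- `φ = desc φ ∘ diff`. -/
  fac : ∀ {A : AbelianVariety k} (φ : C ⊗ C ⟶ A.X) (hφ : lift (𝟙 C) (𝟙 C) ≫ φ = 1),
    diff ≫ (desc φ hφ).hom.hom.hom = φ
  /-- `desc φ` is the only homomorphism `ψ : J → A` with `φ = ψ ∘ diff`. -/
  uniq : ∀ {A : AbelianVariety k} (φ : C ⊗ C ⟶ A.X) (hφ : lift (𝟙 C) (𝟙 C) ≫ φ = 1)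
    (ψ : J ⟶ A), diff ≫ ψ.hom.hom.hom = φ → ψ = desc φ hφ

namespace Jacobian

variable {C C' C'' : SchemeOver k} (𝒥 : Jacobian C) (𝒥' : Jacobian C') (𝒥'' : Jacobian C'')

/-! ### Consequences of the cocycle identity and of the universal property -/

/-- `[x − x] = 0`: the difference map is trivial on the diagonal (Milne §6, "`F` is zero on the
diagonal"; here derived from the cocycle identity at `(x, x, x)`). [cite: Milne1986JacobianVarieties, §6 (before Prop. 6.4)] -/
theorem diag_diff : lift (𝟙 C) (𝟙 C) ≫ 𝒥.diff = 1 := by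
  have h := congrArg (fun g => lift (𝟙 C) (lift (𝟙 C) (𝟙 C)) ≫ g) 𝒥.diff_cocycle
  simp only [MonObj.comp_mul, comp_lift_assoc, lift_fst, lift_snd_assoc, lift_snd] at h
  exact mul_eq_left.mp h

/-- `[y − x] = −[x − y]` (cocycle identity at `(x, y, x)`). [cite: Milne1986JacobianVarieties, §6 (definition of F)] -/
theorem diff_swap : lift (snd C C) (fst C C) ≫ 𝒥.diff = (𝒥.diff)⁻¹ := by
  have h := congrArg (fun g => lift (fst C C) (lift (snd C C) (fst C C)) ≫ g) 𝒥.diff_cocycle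
  simp only [MonObj.comp_mul, comp_lift_assoc, lift_fst, lift_snd_assoc, lift_snd, lift_fst_snd,
    Category.id_comp] at h
  have h1 : lift (fst C C) (fst C C) ≫ 𝒥.diff = 1 := by
    rw [show lift (fst C C) (fst C C) = fst C C ≫ lift (𝟙 C) (𝟙 C) by simp, Category.assoc,
      diag_diff, MonObj.comp_one]
  rw [h1] at h
  exact eq_inv_of_mul_eq_one_right h

/-- **The image of the difference map generates `J`**: two homomorphisms `J → A` which agree after
composition with `diff` are equal (uniqueness half of Milne Prop. 6.4). [cite: Milne1986JacobianVarieties, §6 Prop. 6.4] -/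
theorem hom_ext {A : AbelianVariety k} (ψ ψ' : 𝒥.J ⟶ A)
    (h : 𝒥.diff ≫ ψ.hom.hom.hom = 𝒥.diff ≫ ψ'.hom.hom.hom) : ψ = ψ' := by
  have hφ : lift (𝟙 C) (𝟙 C) ≫ (𝒥.diff ≫ ψ'.hom.hom.hom) = 1 := by
    rw [← Category.assoc, diag_diff, MonObj.one_comp]
  exact (𝒥.uniq _ hφ ψ h).trans (𝒥.uniq _ hφ ψ' rfl).symm

/-- **Uniqueness of the Jacobian**: two Jacobians of `C` are isomorphic by a unique isomorphism
compatible with the difference maps (Milne §1: "`(J, ι)` is uniquely determined up to a unique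
isomorphism"; Remark 6.5). The compatibility is `diff_comp_uniqueUpToIso_hom`, uniqueness is
`hom_ext`. [cite: Milne1986JacobianVarieties, §1 (after Thm. 1.1) and Remark 6.5] -/
def uniqueUpToIso (𝒥₁ 𝒥₂ : Jacobian C) : 𝒥₁.J ≅ 𝒥₂.J where
  hom := 𝒥₁.desc 𝒥₂.diff 𝒥₂.diag_diff
  inv := 𝒥₂.desc 𝒥₁.diff 𝒥₁.diag_diff
  hom_inv_id := 𝒥₁.hom_ext _ _ (by
    change 𝒥₁.diff ≫ (𝒥₁.desc 𝒥₂.diff 𝒥₂.diag_diff).hom.hom.hom ≫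
      (𝒥₂.desc 𝒥₁.diff 𝒥₁.diag_diff).hom.hom.hom = 𝒥₁.diff ≫ 𝟙 𝒥₁.J.X
    rw [← Category.assoc, 𝒥₁.fac, 𝒥₂.fac, Category.comp_id])
  inv_hom_id := 𝒥₂.hom_ext _ _ (by
    change 𝒥₂.diff ≫ (𝒥₂.desc 𝒥₁.diff 𝒥₁.diag_diff).hom.hom.hom ≫
      (𝒥₁.desc 𝒥₂.diff 𝒥₂.diag_diff).hom.hom.hom = 𝒥₂.diff ≫ 𝟙 𝒥₂.J.X
    rw [← Category.assoc, 𝒥₂.fac, 𝒥₁.fac, Category.comp_id])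

/-- The isomorphism between two Jacobians carries one difference map to the other. [cite: Milne1986JacobianVarieties, Remark 6.5] -/
theorem diff_comp_uniqueUpToIso_hom (𝒥₁ 𝒥₂ : Jacobian C) :
    𝒥₁.diff ≫ (uniqueUpToIso 𝒥₁ 𝒥₂).hom.hom.hom.hom = 𝒥₂.diff :=
  𝒥₁.fac _ _

/-! ### The canonical maps `f^P : C → J` (Milne §2) and Milne's Prop. 6.1 -/

/-- The structure morphism is natural: `f` followed by `C' → Spec k` is `C → Spec k`. [folklore] -/
@[reassoc]
theorem comp_toSpecOver (f : C ⟶ C') : f ≫ toSpecOver C' = toSpecOver C := by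
  apply Over.OverMorphism.ext
  change f.left ≫ C'.hom = C.hom
  exact Over.w f

/-- A rational point followed by the structure morphism is the identity of `Spec k`. [folklore] -/
@[reassoc]
theorem point_comp_toSpecOver (P : AlgPoints C k) : P ≫ toSpecOver C = 𝟙 _ := by
  apply Over.OverMorphism.ext
  change P.left ≫ C.hom = 𝟙 (Spec (.of k))
  rw [Over.w P]
  simp only [specOver, Over.mk_hom, Algebra.algebraMap_self, CommRingCat.ofHom_id, Spec.map_id]

/-- The **canonical map** `f^P : C → J`, `x ↦ [x − P]`, of a rational point `P ∈ C(k)`: the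
difference map restricted to `C × {P}` (Milne §2, `f^P(Q) = [Q − P]`; Lange §4.1.3, the
Abel–Jacobi map `α_c`). [cite: Milne1986JacobianVarieties, §2 (definition of f^P) and §6] [cite: Lange2023AbelianVarietiesC, §4.1.3 and §4.5.3] -/
def abelJacobi (P : AlgPoints C k) : C ⟶ 𝒥.J.X :=
  lift (𝟙 C) (toSpecOver C ≫ P) ≫ 𝒥.diff

/-- `f^P(P) = 0`. [cite: Milne1986JacobianVarieties, §2] -/
theorem point_comp_abelJacobi (P : AlgPoints C k) : P ≫ 𝒥.abelJacobi P = 1 := by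
  unfold abelJacobi
  rw [comp_lift_assoc, Category.comp_id, ← Category.assoc, point_comp_toSpecOver, Category.id_comp,
    show lift P P = P ≫ lift (𝟙 C) (𝟙 C) by simp, Category.assoc, diag_diff, MonObj.comp_one]

/-- `F(x, y) = f^P(x) − f^P(y)` (Milne §6, the definition of `F`; here a consequence of the cocycle
identity at `(x, P, y)` and `diff_swap`). [cite: Milne1986JacobianVarieties, §6 (before Prop. 6.4)] -/
theorem diff_eq_mul_inv (P : AlgPoints C k) :
    𝒥.diff = (fst C C ≫ 𝒥.abelJacobi P) * (snd C C ≫ 𝒥.abelJacobi P)⁻¹ := by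
  set c : C ⊗ C ⟶ C := toSpecOver (C ⊗ C) ≫ P with hc
  have h := congrArg (fun g => lift (fst C C) (lift c (snd C C)) ≫ g) 𝒥.diff_cocycle
  simp only [MonObj.comp_mul, comp_lift_assoc, lift_fst, lift_snd_assoc, lift_snd,
    lift_fst_snd, Category.id_comp] at h
  have hswap : lift c (snd C C) ≫ 𝒥.diff = (lift (snd C C) c ≫ 𝒥.diff)⁻¹ := by
    rw [show lift c (snd C C) = lift (snd C C) c ≫ lift (snd C C) (fst C C) by simp,
      Category.assoc, diff_swap, GrpObj.comp_inv]
  have h1 : fst C C ≫ 𝒥.abelJacobi P = lift (fst C C) c ≫ 𝒥.diff := by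
    rw [hc, abelJacobi, comp_lift_assoc, Category.comp_id, comp_toSpecOver_assoc]
  have h2 : snd C C ≫ 𝒥.abelJacobi P = lift (snd C C) c ≫ 𝒥.diff := by
    rw [hc, abelJacobi, comp_lift_assoc, Category.comp_id, comp_toSpecOver_assoc]
  rw [h1, h2, ← hswap, h]

variable {𝒥} in
/-- Homomorphisms out of `J` are determined by their composite with `f^P` ("`f^P(C)` generates
`J`", end of the proof of Milne Prop. 6.1). [cite: Milne1986JacobianVarieties, §6 Prop. 6.1 (proof)] -/
theorem hom_ext_abelJacobi (P : AlgPoints C k) {A : AbelianVariety k} (ψ ψ' : 𝒥.J ⟶ A)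
    (h : 𝒥.abelJacobi P ≫ ψ.hom.hom.hom = 𝒥.abelJacobi P ≫ ψ'.hom.hom.hom) : ψ = ψ' := by
  apply 𝒥.hom_ext
  rw [𝒥.diff_eq_mul_inv P]
  simp only [MonObj.mul_comp, GrpObj.inv_comp, Category.assoc, h]

/-- **Milne, Prop. 6.1 (existence).** For a `k`-morphism `g : C → A` to an abelian variety with
`g(P) = 0`, the homomorphism `ψ : J → A` with `g = ψ ∘ f^P`: the factorisation of
`(x, y) ↦ g(x) − g(y)` through the difference map. [cite: Milne1986JacobianVarieties, §6 Prop. 6.1] [cite: Lange2023AbelianVarietiesC, Thm. 4.5.1] -/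
def descPointed (P : AlgPoints C k) {A : AbelianVariety k} (g : C ⟶ A.X) (_hg : P ≫ g = 1) :
    𝒥.J ⟶ A :=
  𝒥.desc ((fst C C ≫ g) * (snd C C ≫ g)⁻¹) (by
    rw [MonObj.comp_mul, GrpObj.comp_inv, lift_fst_assoc, lift_snd_assoc, Category.id_comp,
      mul_inv_cancel])

/-- `g = ψ ∘ f^P` for `ψ = descPointed P g`. [cite: Milne1986JacobianVarieties, §6 Prop. 6.1] -/
theorem abelJacobi_descPointed (P : AlgPoints C k) {A : AbelianVariety k} (g : C ⟶ A.X)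
    (hg : P ≫ g = 1) : 𝒥.abelJacobi P ≫ (𝒥.descPointed P g hg).hom.hom.hom = g := by
  unfold abelJacobi descPointed
  rw [Category.assoc, 𝒥.fac, MonObj.comp_mul, GrpObj.comp_inv, lift_fst_assoc, lift_snd_assoc,
    Category.id_comp, Category.assoc, hg, MonObj.comp_one, inv_one, mul_one]

/-- **Milne, Prop. 6.1 (uniqueness).** The homomorphism `ψ` with `g = ψ ∘ f^P` is unique. [cite: Milne1986JacobianVarieties, §6 Prop. 6.1] -/
theorem descPointed_unique (P : AlgPoints C k) {A : AbelianVariety k} (g : C ⟶ A.X)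
    (hg : P ≫ g = 1) (ψ : 𝒥.J ⟶ A) (hψ : 𝒥.abelJacobi P ≫ ψ.hom.hom.hom = g) :
    ψ = 𝒥.descPointed P g hg :=
  hom_ext_abelJacobi P _ _ (by rw [hψ, abelJacobi_descPointed])

/-! ### Albanese functoriality: the norm map `Nm_f = f_*` -/

/-- The diagonal is natural: `Δ ∘ f = (f × f) ∘ Δ`. [folklore] -/
theorem diag_comp_tensorHom (f : C ⟶ C') :
    lift (𝟙 C) (𝟙 C) ≫ (f ⊗ₘ f) = f ≫ lift (𝟙 C') (𝟙 C') := by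
  simp

/-- **The norm map `Nm_f = f_* : J(C) → J(C')`** of a `k`-morphism `f : C → C'`: the unique
homomorphism with `f_* [x − y] = [f x − f y]`, i.e. `diff' ∘ (f × f) = f_* ∘ diff`
(`diff_comp_pushforward`), obtained from the universal property; on divisor classes
`[Σ nᵢ xᵢ] ↦ [Σ nᵢ f(xᵢ)]` (Lange §4.5.2: `N_f`, "classically called the norm map of `f`", defined
by `N_f ∘ α_c = α_{f(c)} ∘ f`, which is `abelJacobi_comp_pushforward`). [cite: Lange2023AbelianVarietiesC, §4.5.2 (definition of N_f)] [cite: Milne1986JacobianVarieties, §6 Prop. 6.4] -/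
def pushforward (f : C ⟶ C') : 𝒥.J ⟶ 𝒥'.J :=
  𝒥.desc ((f ⊗ₘ f) ≫ 𝒥'.diff) (by
    rw [← Category.assoc, diag_comp_tensorHom, Category.assoc, diag_diff, MonObj.comp_one])

/-- `f_* [x − y] = [f x − f y]`. [cite: Lange2023AbelianVarietiesC, §4.5.2] -/
@[reassoc]
theorem diff_comp_pushforward (f : C ⟶ C') :
    𝒥.diff ≫ (𝒥.pushforward 𝒥' f).hom.hom.hom = (f ⊗ₘ f) ≫ 𝒥'.diff :=
  𝒥.fac _ _

/-- Lange's defining square of the norm map: `N_f ∘ α_P = α_{f(P)} ∘ f`. [cite: Lange2023AbelianVarietiesC, §4.5.2 (definition of N_f)] -/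
@[reassoc]
theorem abelJacobi_comp_pushforward (f : C ⟶ C') (P : AlgPoints C k) :
    𝒥.abelJacobi P ≫ (𝒥.pushforward 𝒥' f).hom.hom.hom = f ≫ 𝒥'.abelJacobi (P ≫ f) := by
  unfold abelJacobi
  rw [Category.assoc, diff_comp_pushforward, lift_map_assoc, Category.id_comp, comp_lift_assoc,
    Category.comp_id, comp_toSpecOver_assoc, Category.assoc]

/-- `(𝟙_C)_* = 𝟙_J`. [cite: Lange2023AbelianVarietiesC, §4.5.2] -/
@[simp]
theorem pushforward_id : 𝒥.pushforward 𝒥 (𝟙 C) = 𝟙 𝒥.J :=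
  (𝒥.hom_ext _ _ (by
    rw [diff_comp_pushforward, id_tensorHom_id, Category.id_comp]
    exact (Category.comp_id _).symm))

/-- `(g ∘ f)_* = g_* ∘ f_*`. [cite: Lange2023AbelianVarietiesC, §4.5.2] -/
theorem pushforward_comp (f : C ⟶ C') (g : C' ⟶ C'') :
    𝒥.pushforward 𝒥'' (f ≫ g) = 𝒥.pushforward 𝒥' f ≫ 𝒥'.pushforward 𝒥'' g :=
  𝒥.hom_ext _ _ (by
    rw [diff_comp_pushforward]
    change _ = 𝒥.diff ≫ (𝒥.pushforward 𝒥' f).hom.hom.hom ≫ (𝒥'.pushforward 𝒥'' g).hom.hom.hom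
    rw [diff_comp_pushforward_assoc, diff_comp_pushforward, ← Category.assoc,
      tensorHom_comp_tensorHom])

/-- Norm maps between two Jacobians of the same curve along `𝟙_C` are the canonical isomorphism
`uniqueUpToIso`. [cite: Milne1986JacobianVarieties, Remark 6.5] -/
theorem pushforward_id_eq_uniqueUpToIso_hom (𝒥₁ 𝒥₂ : Jacobian C) :
    𝒥₁.pushforward 𝒥₂ (𝟙 C) = (uniqueUpToIso 𝒥₁ 𝒥₂).hom :=
  𝒥₁.hom_ext _ _ (by
    rw [diff_comp_pushforward, id_tensorHom_id, Category.id_comp]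
    exact (diff_comp_uniqueUpToIso_hom 𝒥₁ 𝒥₂).symm)

/-! ### Over `k ⊆ ℂ`: Betti cohomology -/

/-- The square `N_f ∘ α_P = α_{f(P)} ∘ f` in Betti cohomology `Hⁱ(−(ℂ); ℚ)`:
`(α_P)^* ∘ (N_f)^* = f^* ∘ (α_{f(P)})^*` — the compatibility of the comparison maps
`(α_P)^* : Hⁱ(J(ℂ)) → Hⁱ(C(ℂ))` with `f_*` on Jacobians and `f^*` on curves (functoriality of
`bettiCohomology.map`). [cite: Lange2023AbelianVarietiesC, §4.5.2 and proof of Lemma 4.4.1] -/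
theorem bettiCohomology_map_pushforward_comp {k : Type} [Field k] [Algebra k ℂ]
    {C C' : SchemeOver k} (𝒥 : Jacobian C) (𝒥' : Jacobian C') (f : C ⟶ C') (P : AlgPoints C k)
    (i : ℕ) :
    bettiCohomology.map (𝒥.pushforward 𝒥' f).hom.hom.hom i ≫ bettiCohomology.map (𝒥.abelJacobi P) i =
      bettiCohomology.map (𝒥'.abelJacobi (P ≫ f)) i ≫ bettiCohomology.map f i := by
  rw [← bettiCohomology.map_comp, ← bettiCohomology.map_comp, abelJacobi_comp_pushforward]

end Jacobian

/-! ### Existence (named fact) and the Jacobian variety -/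

/-- **Existence of the Jacobian** (Milne Thm. 1.1 with Prop. 6.4: for a complete nonsingular
curve `C` over a field `k` there is an abelian variety `J` over `k` representing `P⁰_C` on
`k`-schemes with a point of `C`, and its difference map `F`, defined over `k`, has the universal
property of Prop. 6.4; Weil 1948 over any field, Chow 1954). Stated for smooth projective
geometrically irreducible curves `IsSmoothProjective 1 C`. [cite: Milne1986JacobianVarieties, Thm. 1.1 and §6 Prop. 6.4] -/
def nonempty_jacobian_of_isSmoothProjective : Prop :=
  ∀ (k : Type u) [Field k] (C : SchemeOver k), IsSmoothProjective 1 C → Nonempty (Jacobian C)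

/-- **The Jacobian variety `J(C)`** of `C`: the abelian variety of a chosen Jacobian of `C`
(all Jacobians of `C` are canonically isomorphic, `Jacobian.uniqueUpToIso`), given that one exists —
`h` is supplied by `nonempty_jacobian_of_isSmoothProjective` for smooth projective curves
(Milne Thm. 1.1). [cite: Milne1986JacobianVarieties, §1 Thm. 1.1 (definition of the Jacobian variety)] -/
def jacobianVariety (C : SchemeOver k) (h : Nonempty (Jacobian C)) : AbelianVariety k :=
  (Classical.choice h).J

/-- The chosen Jacobian structure (difference map and universal property) on `jacobianVariety C h`.
[cite: Milne1986JacobianVarieties, §1 Thm. 1.1 and §6 Prop. 6.4] -/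
def jacobian (C : SchemeOver k) (h : Nonempty (Jacobian C)) : Jacobian C :=
  Classical.choice h

/-- `jacobianVariety C h` is the abelian variety of `jacobian C h` (by `rfl`). [folklore] -/
@[simp]
theorem jacobian_J (C : SchemeOver k) (h : Nonempty (Jacobian C)) :
    (jacobian C h).J = jacobianVariety C h :=
  rfl

/-! ### Named facts over `ℂ`: `H¹` and the dimension -/

/-- **`H¹` of the Jacobian** (over `ℂ`): for a smooth projective curve `C/ℂ` with a point `P`,
pull-back along the canonical map `f^P : C → J` is an isomorphism `H¹(J(ℂ); ℚ) ≅ H¹(C(ℂ); ℚ)`.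
Lange §4.1.1: `J(C) = H⁰(ω_C)^∨ / H₁(C, ℤ)`, so `H₁(J, ℤ) = H₁(C, ℤ)` via `α_{c*}`, and (proof of
Lemma 4.4.1) `α_c^* : H¹(J, ℤ) → H¹(C, ℤ)` is "the transposed map of the isomorphism
`α_{c*} : H₁(C, ℤ) → H₁(J, ℤ)`"; Milne Thm. 2.5 identifies this analytic Jacobian and `g^P` with
the algebraic `J` and `f^P`, and every `Jacobian C` is the algebraic one up to an isomorphism
carrying `f^P` to `f^P` (`Jacobian.uniqueUpToIso`). [cite: Lange2023AbelianVarietiesC, §4.1.1 and Lemma 4.4.1 (proof)] [cite: Milne1986JacobianVarieties, §2 Thm. 2.5] -/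
def isIso_bettiCohomology_map_abelJacobi : Prop :=
  ∀ (C : SchemeOver ℂ), IsSmoothProjective 1 C → ∀ (𝒥 : Jacobian C) (P : AlgPoints C ℂ),
    IsIso (bettiCohomology.map (𝒥.abelJacobi P) 1)

/-- **`dim J(C) = g(C)`** (Milne Prop. 2.1), over `ℂ` and with the genus read off topologically:
`2 · dim J = b₁(C(ℂ)) = dim_ℚ H¹(C(ℂ); ℚ)` (Lange §4.1.1: `H₁(C, ℤ)` is free of rank `2g` and
`J(C) = H⁰(ω_C)^∨/H₁(C, ℤ)` is a complex torus of dimension `g = dim H⁰(ω_C)`; Milne Thm. 2.5).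
The right-hand side is `2 · Literature.NumberTheory.DiophantineGeometry.genus C`.
[cite: Milne1986JacobianVarieties, §2 Prop. 2.1 and Thm. 2.5] [cite: Lange2023AbelianVarietiesC, §4.1.1] -/
def two_mul_dim_eq_finrank_bettiCohomology : Prop :=
  ∀ (C : SchemeOver ℂ), IsSmoothProjective 1 C → ∀ (𝒥 : Jacobian C),
    2 * 𝒥.J.dim = Module.finrank ℚ (bettiCohomology C 1)

end Literature.AlgebraicGeometry.Motives

end
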